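import Literature.AlgebraicGeometry.Resolution.BlowupSequencesExtensions
import Literature.AlgebraicGeometry.Resolution.KollarPushforward
import Literature.AlgebraicGeometry.Resolution.IsoLocusOfClosure
import HarnessLib

/-!
# [OURS · L1 W4.2] D8-S1 infrastructure, file 3: blow-ups RESTRICTED OVER AN OPEN — the open immersions `ι` of the run-level
# Zariski localisation through idle and genuine steps, push–pull of centres, restriction of the replayed closed subschemes
# (crux chain w42, v7 stub `stub_isoOpenRestartLocal` ⟸ `LocalRunSimulationM p`; hand res-D-pv-060)

OURS plumbing (cell `res-hironaka`, slot W4.2, crux `stmt-ResolutionOfSingularities-18506` / conjunct `-19249`; `--supports … --as helper`,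
counted 0); scheme-theoretic folklore over Mathlib's `blowup` / `IdealSheafData.map/comap` and the tree's `IsBlowup`,
`blowup.map/comapMap`, `blowup.pushforwardMap`; NOT statements of the manuscript under review [claim: Hironaka2017, status: under-review]
nor of [CossartJannsenSaito2020]. AI plumbing, weaker than expert review.

Along the simulation of D8-S1 (DESIGN §2) the pointed open `u` of the global stage `s` is carried by an open immersion `ι : u ⟶ s`;
at a global blow-up `Bl_C(s) → s` either the open is NOT blown up (the centre misses the range of `ι`: `ι` LIFTS into `Bl_C(s)`,
`exists_lift_off_centre`, GW Prop. 13.91 (3)) or it is blown up along `ι^* C` (`blowup.map C ι : Bl_{ι^*C}(u) ⟶ Bl_C(s)`, an open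
immersion with range `π_C⁻¹(range ι)`, `range_blowupMap`, GW Prop. 13.91 (2)). The replayed lower-dimensional data restrict along
cartesian squares over `ι`: kernels commute with the flat base change `ι` (tree `DepthGraded.ker_eq_comap_of_isPullback`, inlined), so the push-forward of a
centre restricts to the push-forward of the restricted centre (`comap_map_eq_map_comap_of_isPullback`, GW (13.19)), the replayed closed
subscheme restricts to an open piece (`exists_subscheme_restrict`), and the strict-transform closed immersion `Bl(φ)` restricts to
the strict-transform closed immersion of the restriction (`exists_pushforwardMap_restrict`, GW Prop. 13.96 (2)); when the restricted
centre is EMPTY the replayed piece lifts unchanged (`exists_lift_src_off_centre`). [folklore]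
-/

noncomputable section

set_option linter.dupNamespace false -- mandated namespace of this single-conjunct summit

open CategoryTheory CategoryTheory.Limits AlgebraicGeometry TopologicalSpace

universe u

namespace Summit.ResolutionOfSingularities.ResolutionOfSingularities.Cruxes.SigmaMaxModifications.IdeasL1Idea2R4

open Literature.AlgebraicGeometry.Resolution

/-! ## §1. The open is not blown up: lifting `ι` off the centre -/

/-- **An open immersion missing the centre lifts into the blow-up** (the blow-up is an isomorphism over the complement of the
centre, GW Prop. 13.91 (3)): `ι' : u ⟶ Bl_C(s)` open immersion, `ι' ≫ π_C = ι`, `range ι' = π_C⁻¹(range ι)`.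
[cite: GortzWedhorn2020, Prop. 13.91 (3)] -/
theorem exists_lift_off_centre {V W : Scheme.{u}} (ι : V ⟶ W) [IsOpenImmersion ι] (C : W.IdealSheafData)
    (h : Disjoint (Set.range ι.base) (C.support : Set W)) :
    ∃ ι' : V ⟶ blowup C, IsOpenImmersion ι' ∧ ι' ≫ blowup.π C = ι ∧
      Set.range ι'.base = (blowup.π C).base ⁻¹' Set.range ι.base := by
  set O : W.Opens := ι.opensRange with hO
  have hOc : (O : Set W) = Set.range ι.base := ι.coe_opensRange
  have hiso : IsIso (blowup.π C ∣_ O) := (blowup.isBlowup C).isIso_morphismRestrict (by rw [hOc]; exact h)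
  haveI := isOpenImmersion_ι_comp_of_isIso_morphismRestrict (blowup.π C) O hiso
  have hrange : Set.range ((blowup.π C ⁻¹ᵁ O).ι ≫ blowup.π C).base = (O : Set W) :=
    range_ι_comp_of_isIso_morphismRestrict (blowup.π C) O hiso
  have hsub : Set.range ι.base ⊆ Set.range ((blowup.π C ⁻¹ᵁ O).ι ≫ blowup.π C).base := by
    rw [hrange, hOc]
  refine ⟨IsOpenImmersion.lift _ ι hsub ≫ (blowup.π C ⁻¹ᵁ O).ι, ?_, ?_, ?_⟩
  · haveI : IsOpenImmersion (IsOpenImmersion.lift ((blowup.π C ⁻¹ᵁ O).ι ≫ blowup.π C) ι hsub) := by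
      have : IsOpenImmersion (IsOpenImmersion.lift ((blowup.π C ⁻¹ᵁ O).ι ≫ blowup.π C) ι hsub ≫
          ((blowup.π C ⁻¹ᵁ O).ι ≫ blowup.π C)) := by
        rw [IsOpenImmersion.lift_fac]
        infer_instance
      exact IsOpenImmersion.of_comp _ ((blowup.π C ⁻¹ᵁ O).ι ≫ blowup.π C)
    infer_instance
  · rw [Category.assoc, IsOpenImmersion.lift_fac]
  · rw [Scheme.Hom.comp_base, TopCat.coe_comp, Set.range_comp,
      Set.range_eq_univ.mpr ?_, Set.image_univ, Scheme.Opens.range_ι, TopologicalSpace.Opens.map_coe, hOc]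
    · -- the lift is surjective: `lift ≫ j = ι` with `j` injective and `range j = range ι`
      intro y
      have hy : ((blowup.π C ⁻¹ᵁ O).ι ≫ blowup.π C).base y ∈ Set.range ι.base := by
        rw [← hOc, ← hrange]; exact ⟨y, rfl⟩
      obtain ⟨x, hx⟩ := hy
      refine ⟨x, ?_⟩
      apply ((blowup.π C ⁻¹ᵁ O).ι ≫ blowup.π C).isOpenEmbedding.injective
      rw [← Scheme.Hom.comp_apply, IsOpenImmersion.lift_fac, hx]

/-! ## §2. The open is blown up: `Bl(ι) : Bl_{ι^*C}(u) ⟶ Bl_C(s)` -/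

/-- **The range of `Bl(ι)` is `π_C⁻¹(range ι)`** (the blow-up square over an open immersion is cartesian, GW Prop. 13.91 (2); tree
`blowup.isPullback_map`). [cite: GortzWedhorn2020, Prop. 13.91 (2)] -/
theorem range_blowupMap {V W : Scheme.{u}} (C : W.IdealSheafData) (ι : V ⟶ W) [IsOpenImmersion ι] :
    Set.range (blowup.map C ι).base = (blowup.π C).base ⁻¹' Set.range ι.base := by
  have H := blowup.isPullback_map C ι
  have hsurj : Function.Surjective H.isoPullback.hom.base := H.isoPullback.hom.homeomorph.surjective
  rw [← H.isoPullback_hom_fst, Scheme.Hom.comp_base, TopCat.coe_comp, Set.range_comp,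
    Set.range_eq_univ.mpr hsurj, Set.image_univ, Scheme.Pullback.range_fst]

/-- A point of `Bl_C(s)` over the range of `ι` comes from `Bl_{ι^*C}(u)`. [cite: GortzWedhorn2020, Prop. 13.91 (2)] -/
theorem exists_blowupMap_eq {V W : Scheme.{u}} (C : W.IdealSheafData) (ι : V ⟶ W) [IsOpenImmersion ι]
    {x' : ↥(blowup C)} (hx' : (blowup.π C).base x' ∈ Set.range ι.base) :
    ∃ y' : ↥(blowup (C.comap ι)), (blowup.map C ι).base y' = x' := by
  have : x' ∈ Set.range (blowup.map C ι).base := by rw [range_blowupMap]; exact hx'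
  exact this
/-! ## §3. Cartesian squares over the open immersion: kernels, supports, replayed subschemes, push–pull -/

/-- **`ι^* K` is the unit ideal iff the range of `ι` misses `V(K)`.** [folklore] -/
theorem comap_eq_top_iff_disjoint {V W : Scheme.{u}} (ι : V ⟶ W) (K : W.IdealSheafData) :
    K.comap ι = ⊤ ↔ Disjoint (Set.range ι.base) (K.support : Set W) := by
  rw [← Scheme.IdealSheafData.support_eq_bot_iff, ← SetLike.coe_injective.eq_iff,
    Scheme.IdealSheafData.support_comap, Closeds.coe_preimage, Closeds.coe_bot, Set.preimage_eq_empty_iff, disjoint_comm]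

/-- **Pushing forward along a closed immersion detects the unit ideal**: `φ_* K = ⊤ ↔ K = ⊤`. [folklore] -/
theorem map_eq_top_iff {S W : Scheme.{u}} (φ : S ⟶ W) [IsClosedImmersion φ] (K : S.IdealSheafData) :
    K.map φ = ⊤ ↔ K = ⊤ := by
  refine ⟨fun h => map_injective_of_isClosedImmersion φ ?_, fun h => by rw [h, Scheme.IdealSheafData.map_top]⟩
  change K.map φ = (⊤ : S.IdealSheafData).map φ
  rw [h, Scheme.IdealSheafData.map_top]

/-- **A closed subscheme restricts to an open piece along an open immersion**: for `J = ι^* I` the comparison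
`V(J) ⟶ V(I)` (Mathlib `subschemeMap`) is an open immersion and the square over `ι` is cartesian. [folklore] -/
theorem exists_subschemeMap_of_comap {V W : Scheme.{u}} (ι : V ⟶ W) [IsOpenImmersion ι] (I : W.IdealSheafData)
    (J : V.IdealSheafData) (h : J = I.comap ι) :
    ∃ jT : J.subscheme ⟶ I.subscheme, IsOpenImmersion jT ∧ IsPullback jT J.subschemeι I.subschemeι ι := by
  subst h
  refine ⟨(I.comapIso ι).hom ≫ pullback.snd ι I.subschemeι, inferInstance, ?_⟩
  have hsq : IsPullback (pullback.snd ι I.subschemeι) (pullback.fst ι I.subschemeι) I.subschemeι ι :=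
    (IsPullback.of_hasPullback ι I.subschemeι).flip
  refine (hsq.of_iso (I.comapIso ι).symm (Iso.refl _) (Iso.refl _) (Iso.refl _) ?_ ?_ ?_ ?_)
  all_goals simp [Iso.eq_inv_comp]

/-- **Push–pull of centres over the open** (GW (13.19) for the flat base change `ι`): for a cartesian square `jP ≫ φ = φ' ≫ ι` with `φ`
a closed immersion and `ι` an open immersion, restricting the push-forward of a centre `D` of `S` to the open equals pushing forward
its restriction: `ι^*(φ_* D) = φ'_*(jP^* D)`. [cite: GortzWedhorn2020, (13.19)] -/
theorem comap_map_eq_map_comap_of_isPullback {S S' V W : Scheme.{u}} {φ : S ⟶ W} [IsClosedImmersion φ] {ι : V ⟶ W}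
    [IsOpenImmersion ι] {jP : S' ⟶ S} {φ' : S' ⟶ V} (H : IsPullback jP φ' φ ι) (D : S.IdealSheafData) :
    (D.map φ).comap ι = (D.comap jP).map φ' := by
  -- the square `V(jP^* D) → V(D)` over `jP`, pasted over `H`
  have hA : IsPullback (pullback.snd jP D.subschemeι) (pullback.fst jP D.subschemeι) D.subschemeι jP :=
    (IsPullback.of_hasPullback jP D.subschemeι).flip
  have hbig : IsPullback (pullback.snd jP D.subschemeι) (pullback.fst jP D.subschemeι ≫ φ') (D.subschemeι ≫ φ) ι :=
    hA.paste_vert H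
  -- kernels commute with the open base change `ι` (tree `DepthGraded.ker_eq_comap_of_isPullback`, Stacks 081I; two lines inlined
  -- to keep this file's imports light)
  have hker : (pullback.fst jP D.subschemeι ≫ φ').ker = (D.subschemeι ≫ φ).ker.comap ι := by
    refine Scheme.IdealSheafData.ext (funext fun U => ?_)
    rw [Scheme.ker_ideal_of_isPullback_of_isOpenImmersion _ _ _ _ hbig.flip U,
      Scheme.IdealSheafData.ideal_comap_of_isOpenImmersion]
  calc (D.map φ).comap ι = (D.subschemeι ≫ φ).ker.comap ι := rfl
    _ = (pullback.fst jP D.subschemeι ≫ φ').ker := hker.symm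
    _ = ((D.comapIso jP).inv ≫ ((D.comap jP).subschemeι ≫ φ')).ker := by
        rw [← Category.assoc, Scheme.IdealSheafData.comapIso_inv_subschemeι]
    _ = ((D.comap jP).subschemeι ≫ φ').ker := Scheme.Hom.ker_comp_of_isIso _ _
    _ = (D.comap jP).map φ' := rfl

/-- **Supports under push–pull**: the restricted centre `jP^* D` is empty iff the pushed-forward centre `φ_* D` misses the range of
`ι`. [folklore] -/
theorem comap_eq_top_iff_disjoint_support_map {S S' V W : Scheme.{u}} {φ : S ⟶ W} [IsClosedImmersion φ] {ι : V ⟶ W}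
    [IsOpenImmersion ι] {jP : S' ⟶ S} {φ' : S' ⟶ V} (H : IsPullback jP φ' φ ι) (D : S.IdealSheafData) :
    D.comap jP = ⊤ ↔ Disjoint (Set.range ι.base) ((D.map φ).support : Set W) := by
  haveI : IsClosedImmersion φ' := MorphismProperty.of_isPullback H inferInstance
  rw [← comap_eq_top_iff_disjoint, comap_map_eq_map_comap_of_isPullback H, map_eq_top_iff]

/-- **The range of the restricted replayed piece**: `range jP = φ⁻¹(range ι)`. [folklore] -/
theorem range_eq_preimage_range_of_isPullback {S S' V W : Scheme.{u}} {φ : S ⟶ W} {ι : V ⟶ W} {jP : S' ⟶ S} {φ' : S' ⟶ V}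
    (H : IsPullback jP φ' φ ι) : Set.range jP.base = φ.base ⁻¹' Set.range ι.base := by
  have hsurj : Function.Surjective H.isoPullback.hom.base := H.isoPullback.hom.homeomorph.surjective
  rw [← H.isoPullback_hom_fst, Scheme.Hom.comp_base, TopCat.coe_comp, Set.range_comp,
    Set.range_eq_univ.mpr hsurj, Set.image_univ, Scheme.Pullback.range_fst]

/-! ## §4. The replayed closed immersion `Bl(φ) : Bl_D(S) ⟶ Bl_C(W)` restricted over the open -/

section StrictTransform

variable {S S' V W : Scheme.{u}} {φ : S ⟶ W} {ι : V ⟶ W} [IsOpenImmersion ι] {jP : S' ⟶ S} [IsOpenImmersion jP]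
  {φ' : S' ⟶ V} {D : S.IdealSheafData} {C : W.IdealSheafData} {ψ : blowup D ⟶ blowup C}

omit [IsOpenImmersion ι] in
/-- **`ψ⁻¹(π_C⁻¹(range ι)) = range Bl(jP)`** for `ψ : Bl_D(S) ⟶ Bl_C(W)` over `φ` and the cartesian square `jP ≫ φ = φ' ≫ ι`.
[cite: GortzWedhorn2020, Prop. 13.91 (2)] -/
theorem preimage_preimage_range_eq_range_blowupMap (H : IsPullback jP φ' φ ι) (hψ : ψ ≫ blowup.π C = blowup.π D ≫ φ) :
    ψ.base ⁻¹' ((blowup.π C).base ⁻¹' Set.range ι.base) = Set.range (blowup.map D jP).base := by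
  rw [range_blowupMap, range_eq_preimage_range_of_isPullback H, ← Set.preimage_comp, ← Set.preimage_comp]
  congr 1
  ext x
  change (ψ ≫ blowup.π C).base x = (blowup.π D ≫ φ).base x
  rw [hψ]

/-- **The replayed closed immersion restricts** (GW Prop. 13.96 (2) over the open): given `ψ : Bl_D(S) ⟶ Bl_C(W)`, a closed
immersion over `φ`, and the cartesian square `jP ≫ φ = φ' ≫ ι`, there is a closed immersion `ψ' : Bl_{jP^*D}(S') ⟶ Bl_{ι^*C}(V)` over
`φ'` whose square with `ψ` over `Bl(ι)` (and `Bl(jP)`) is cartesian. [cite: GortzWedhorn2020, Prop. 13.96 (2), Prop. 13.91 (2)] -/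
theorem exists_pushforwardMap_restrict [IsClosedImmersion ψ] (H : IsPullback jP φ' φ ι)
    (hψ : ψ ≫ blowup.π C = blowup.π D ≫ φ) :
    ∃ ψ' : blowup (D.comap jP) ⟶ blowup (C.comap ι), IsClosedImmersion ψ' ∧
      ψ' ≫ blowup.π (C.comap ι) = blowup.π (D.comap jP) ≫ φ' ∧
      IsPullback (blowup.map D jP) ψ' ψ (blowup.map C ι) := by
  have sqC := blowup.isPullback_map C ι
  have w : (blowup.map D jP ≫ ψ) ≫ blowup.π C = (blowup.π (D.comap jP) ≫ φ') ≫ ι := by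
    rw [Category.assoc, hψ, ← Category.assoc, blowup.map_π, Category.assoc, H.w, Category.assoc]
  set ψ' := sqC.lift (blowup.map D jP ≫ ψ) (blowup.π (D.comap jP) ≫ φ') w with hψ'def
  have h1 : ψ' ≫ blowup.map C ι = blowup.map D jP ≫ ψ := sqC.lift_fst _ _ w
  have h2 : ψ' ≫ blowup.π (C.comap ι) = blowup.π (D.comap jP) ≫ φ' := sqC.lift_snd _ _ w
  -- the square is cartesian: open immersions `Bl(jP)`, `Bl(ι)` with `ψ⁻¹(range Bl(ι)) = range Bl(jP)`
  have hsq : IsPullback (blowup.map D jP) ψ' ψ (blowup.map C ι) := by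
    refine (IsOpenImmersion.isPullback ψ' (blowup.map D jP) (blowup.map C ι) ψ h1.symm ?_).flip
    ext1
    rw [Scheme.Hom.coe_opensRange, TopologicalSpace.Opens.map_coe, Scheme.Hom.coe_opensRange, range_blowupMap C ι,
      preimage_preimage_range_eq_range_blowupMap H hψ]
  exact ⟨ψ', MorphismProperty.of_isPullback hsq inferInstance, h2, hsq⟩

/-- **When the restricted centre is empty the replayed piece lifts unchanged**: if `jP^* D = ⊤` and `ι' : V ⟶ Bl_C(W)` lifts `ι` with
range `π_C⁻¹(range ι)`, then `jP' := π_{jP^*D}⁻¹ ≫ Bl(jP) : S' ⟶ Bl_D(S)` is an open immersion over `jP` whose square with `ψ` over `ι'`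
is cartesian. [cite: GortzWedhorn2020, Prop. 13.91 (2), (3)] -/
theorem exists_lift_src_off_centre [IsClosedImmersion ψ] (H : IsPullback jP φ' φ ι)
    (hψ : ψ ≫ blowup.π C = blowup.π D ≫ φ) (hD : D.comap jP = ⊤) (ι' : V ⟶ blowup C) [IsOpenImmersion ι']
    (hι' : ι' ≫ blowup.π C = ι) (hrange : Set.range ι'.base = (blowup.π C).base ⁻¹' Set.range ι.base) :
    ∃ jP' : S' ⟶ blowup D, IsOpenImmersion jP' ∧ jP' ≫ blowup.π D = jP ∧ IsPullback jP' φ' ψ ι' := by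
  haveI : IsIso (blowup.π (D.comap jP)) := (blowup.isBlowup (D.comap jP)).isIso (hD ▸ isEffectiveCartier_top)
  set jP' : S' ⟶ blowup D := inv (blowup.π (D.comap jP)) ≫ blowup.map D jP with hjP'
  have hπ : jP' ≫ blowup.π D = jP := by
    rw [hjP', Category.assoc, blowup.map_π, IsIso.inv_hom_id_assoc]
  refine ⟨jP', inferInstance, hπ, ?_⟩
  -- `jP' ≫ ψ` lands in the range of `ι'` and lifts to `φ'` (compare after the monomorphism `ι`)
  have hsub : Set.range (jP' ≫ ψ).base ⊆ Set.range ι'.base := by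
    rw [hrange]
    rintro _ ⟨y, rfl⟩
    refine ⟨φ'.base y, ?_⟩
    change (φ' ≫ ι).base y = ((jP' ≫ ψ) ≫ blowup.π C).base y
    rw [Category.assoc, hψ, ← Category.assoc, hπ, H.w]
  have hlift : IsOpenImmersion.lift ι' (jP' ≫ ψ) hsub = φ' := by
    rw [← cancel_mono ι]
    conv_lhs => rw [← hι']
    rw [← Category.assoc, IsOpenImmersion.lift_fac, Category.assoc, hψ, ← Category.assoc, hπ, H.w]
  have hcomm : jP' ≫ ψ = φ' ≫ ι' := by
    rw [← hlift, IsOpenImmersion.lift_fac]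
  refine (IsOpenImmersion.isPullback φ' jP' ι' ψ hcomm ?_).flip
  have hsurj : Function.Surjective (inv (blowup.π (D.comap jP))).base :=
    (inv (blowup.π (D.comap jP))).homeomorph.surjective
  ext1
  rw [Scheme.Hom.coe_opensRange, TopologicalSpace.Opens.map_coe, Scheme.Hom.coe_opensRange, hrange,
    preimage_preimage_range_eq_range_blowupMap H hψ, hjP', Scheme.Hom.comp_base, TopCat.coe_comp, Set.range_comp,
    Set.range_eq_univ.mpr hsurj, Set.image_univ]

end StrictTransform

end Summit.ResolutionOfSingularities.ResolutionOfSingularities.Cruxes.SigmaMaxModifications.IdeasL1Idea2R4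

end
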